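/-
Copyright (c) 2026. All rights reserved.
Released under Apache 2.0 license as described in the file LICENSE.
Authors: abc-iut cell, statement-typer seat abc-iut-L4-t3 (wave 1).
-/
import Mathlib.RingTheory.PicardGroup
import Literature.AnabelianGeometry.AbsoluteAnabelian.ArithmeticLineBundlesCoordinates
import Literature.AnabelianGeometry.AbsoluteAnabelian.ArithmeticLineBundlesOrders

/-!
# [AbsTopIII] Definition 5.3 (ii): models of `⊞`-line bundles as fractional ideals (proof-only toolkit)

S. Mochizuki, *Topics in absolute anabelian geometry III* [MochizukiAbsTopIII2015], Def 5.3 (i), (ii) pp. 122–124.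
Third step of the DISCHARGE of `AddMulLineBundleCategoriesEquivalent` (`ArithmeticLineBundles.lean`): every `⊞`-line
bundle carries a MODEL `(x₀, c, J)` — a nonzero element, its coordinate `c : L⊞[⊚] ↪ F`, and the fractional ideal
`J = c(L⊞[⊚])` of coordinates; conversely every finitely supported family of orders `(m_v)_v` and every family of
archimedean weights is REALISED by a `⊞`-line bundle (the fractional ideal `∏ v^{m_v}` with the twisted metrics) —
the essential surjectivity of `⊞ → ⊠`. Also: morphisms of `⊠`-line bundles are determined by their torsor maps.
Proof-only (no new notions). Refereed pre-IUT material; nothing here bears on [IUTchIII] Cor. 3.12.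
-/

set_option autoImplicit false

noncomputable section

open NumberField IsDedekindDomain FractionalIdeal
open scoped nonZeroDivisors

namespace Literature.AnabelianGeometry.AbsoluteAnabelian

variable {F : Type} [Field F] [NumberField F]

namespace AddLineBundle

omit [NumberField F] in
/-- the coordinate normalised at `x₀` is UNIQUE. [cite: MochizukiAbsTopIII2015, Def 5.3 (ii) p. 123] -/
theorem coordinate_unique (L : AddLineBundle F) {x₀ : L.L} (hx₀ : x₀ ≠ 0) (c c' : L.L →ₗ[𝓞 F] F) (hc : c x₀ = 1)
    (hc' : c' x₀ = 1) : c = c' := by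
  ext y
  obtain ⟨s, t, ht, h⟩ := L.exists_rep hx₀ y
  rw [L.coordinate_apply c hc ht h, L.coordinate_apply c' hc' ht h]

/-- every `⊞`-line bundle has a MODEL: a nonzero `x₀`, its coordinate `c` (`c x₀ = 1`) and the nonzero fractional ideal
`J = c(L⊞[⊚]) ⊆ F` of coordinates (`L⊞[⊚] = J · x₀` inside `L⊞[⊚] ⊗ F = F · x₀`).
[cite: MochizukiAbsTopIII2015, Def 5.3 (ii) p. 123] -/
theorem exists_model (L : AddLineBundle F) :
    ∃ (x₀ : L.L) (c : L.L →ₗ[𝓞 F] F) (J : FractionalIdeal (𝓞 F)⁰ F),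
      x₀ ≠ 0 ∧ c x₀ = 1 ∧ J ≠ 0 ∧ ∀ a : F, a ∈ J ↔ ∃ y : L.L, c y = a := by
  obtain ⟨x₀, hx₀⟩ := L.exists_ne_zero
  obtain ⟨c, hc⟩ := L.exists_coordinate hx₀
  have hfg : (LinearMap.range c).FG := by
    rw [LinearMap.range_eq_map]
    exact Module.Finite.fg_top.map c
  set J : FractionalIdeal (𝓞 F)⁰ F := ⟨LinearMap.range c, isFractional_of_fg hfg⟩ with hJ
  have hmem : ∀ a : F, a ∈ J ↔ ∃ y : L.L, c y = a := fun a => Iff.rfl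
  refine ⟨x₀, c, J, hx₀, hc, fun h0 => ?_, hmem⟩
  have h1 : (1 : F) ∈ J := (hmem 1).mpr ⟨x₀, hc⟩
  rw [h0] at h1
  exact one_ne_zero ((mem_zero_iff (𝓞 F)⁰).mp h1)

/-- REALISATION of prescribed orders and weights by a `⊞`-line bundle: for a finitely supported `m : V^non → ℤ` and
weights `r : V^arc → ℝ`, the fractional ideal `J = ∏ v^{m_v}` (an invertible, hence finitely generated projective
rank-one `𝒪_F`-module) with the Hermitian norms `|y|_v := |y|_v · e^{r_v}` is a `⊞`-line bundle whose elements are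
exactly the `a ∈ F` with `ord_v(a) ≥ m_v` for all `v`. [cite: MochizukiAbsTopIII2015, Def 5.3 (ii) p. 123] -/
theorem exists_of_orders (m : HeightOneSpectrum (𝓞 F) → ℤ)
    (hm : ∀ᶠ v : HeightOneSpectrum (𝓞 F) in Filter.cofinite, m v = 0) (r : InfinitePlace F → ℝ) :
    ∃ (L : AddLineBundle F) (ι : L.L →ₗ[𝓞 F] F), Function.Injective ι ∧
      (∀ a : F, a ≠ 0 → ((∃ y, ι y = a) ↔ ∀ v, m v ≤ Literature.IUT.LogVolume.ord F v a)) ∧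
      (∃ y, ι y ≠ 0) ∧ ∀ (v : InfinitePlace F) (y : L.L), L.norm v y = v (ι y) * Real.exp (r v) := by
  set J : FractionalIdeal (𝓞 F)⁰ F :=
    ∏ᶠ v : HeightOneSpectrum (𝓞 F), (v.asIdeal : FractionalIdeal (𝓞 F)⁰ F) ^ m v with hJ
  have hJ0 : J ≠ 0 := LineBundleOrders.finprod_zpow_ne_zero m
  set P : Submodule (𝓞 F) F := (J : Submodule (𝓞 F) F) with hP
  have hmemP : ∀ a : F, a ∈ P ↔ a ∈ J := fun a => Iff.rfl
  haveI : IsNoetherian (𝓞 F) P := FractionalIdeal.isNoetherian J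
  have hunit : IsUnit P := (isUnit_iff_ne_zero.mpr hJ0).map (coeSubmoduleHom (𝓞 F)⁰ F)
  have hproj : Module.Projective (𝓞 F) P := Submodule.projective_of_isUnit hunit
  -- a nonzero element
  obtain ⟨a₀, ha₀J, ha₀⟩ : ∃ a ∈ J, a ≠ (0 : F) := by
    by_contra h
    push Not at h
    exact hJ0 (eq_zero_iff.mpr h)
  -- rank one
  have hrank : Module.rank (𝓞 F) P = 1 := by
    apply le_antisymm
    · refine rank_le fun s hs => ?_
      by_contra hcard
      push Not at hcard
      obtain ⟨a, ha, b, hb, hab⟩ := Finset.one_lt_card.mp hcard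
      obtain ⟨pa, qa, hqa, hpa⟩ := IsFractionRing.div_surjective (A := 𝓞 F) ((a : P) : F)
      obtain ⟨pb, qb, hqb, hpb⟩ := IsFractionRing.div_surjective (A := 𝓞 F) ((b : P) : F)
      have hqa0 : (algebraMap (𝓞 F) F qa) ≠ 0 := RingOfIntegers.coe_ne_zero_iff.mpr (nonZeroDivisors.ne_zero hqa)
      have hqb0 : (algebraMap (𝓞 F) F qb) ≠ 0 := RingOfIntegers.coe_ne_zero_iff.mpr (nonZeroDivisors.ne_zero hqb)
      -- the dependence relation `(qa * pb) • a - (qb * pa) • b = 0`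
      have hdep : (qa * pb) • (a : P) + (-(qb * pa)) • (b : P) = 0 := by
        apply Subtype.ext
        change ((qa * pb : 𝓞 F) : F) * (a : F) + ((-(qb * pa) : 𝓞 F) : F) * (b : F) = 0
        rw [← hpa, ← hpb]
        simp only [map_mul, map_neg]
        field_simp
        ring
      have hpair : LinearIndependent (𝓞 F) ![(a : P), (b : P)] := by
        have hinj : Function.Injective (fun i : Fin 2 => (![(⟨a, ha⟩ : s), ⟨b, hb⟩] i)) := by
          intro i j hij
          fin_cases i <;> fin_cases j
          · rfl
          · exact absurd (congrArg (fun z : s => (z : P)) hij) hab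
          · exact absurd (congrArg (fun z : s => (z : P)) hij).symm hab
          · rfl
        have h2 := hs.comp _ hinj
        convert h2 using 1
        ext i
        fin_cases i <;> rfl
      obtain ⟨h1, -⟩ := LinearIndependent.pair_iff.mp hpair (qa * pb) (-(qb * pa)) hdep
      rcases mul_eq_zero.mp h1 with h1 | h1
      · exact nonZeroDivisors.ne_zero hqa h1
      · have hb0 : (b : P) = 0 := by
          apply Subtype.ext; change (b : F) = 0; rw [← hpb, h1, map_zero, zero_div]
        exact hpair.ne_zero 1 hb0
    · haveI : Module.IsTorsionFree (𝓞 F) P := inferInstance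
      have hli : LinearIndependent (𝓞 F) (fun _ : Fin 1 => (⟨a₀, ha₀J⟩ : P)) := by
        rw [linearIndependent_unique_iff]
        exact fun h => ha₀ (congrArg Subtype.val h)
      simpa using hli.cardinal_le_rank
  let L : AddLineBundle F :=
    { L := P
      projective := hproj
      rank_eq_one := hrank
      norm := fun v y => v (y : F) * Real.exp (r v)
      norm_nonneg := fun v y => mul_nonneg (apply_nonneg v _) (Real.exp_nonneg _)
      norm_eq_zero_iff := fun v y => by
        rw [mul_eq_zero, map_eq_zero]
        constructor
        · rintro (h | h)
          · exact Subtype.ext h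
          · exact absurd h (Real.exp_ne_zero _)
        · intro h; left; rw [h]; rfl
      norm_smul := fun v a y => by
        change v (((a : 𝓞 F) : F) * (y : F)) * Real.exp (r v) = v (a : F) * (v (y : F) * Real.exp (r v))
        rw [map_mul, mul_assoc] }
  refine ⟨L, P.subtype, Subtype.val_injective, fun a ha => ?_, ⟨⟨a₀, ha₀J⟩, ha₀⟩, fun v y => rfl⟩
  rw [← LineBundleOrders.mem_finprod_zpow_iff m hm ha]
  constructor
  · rintro ⟨y, rfl⟩; exact y.2
  · intro h; exact ⟨⟨a, h⟩, rfl⟩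

end AddLineBundle

namespace MulLineBundle

/-- a morphism of `⊠`-line bundles is determined by its map of torsors. [cite: MochizukiAbsTopIII2015, Def 5.3 (i) p. 123] -/
theorem Hom.ext' {M₁ M₂ : MulLineBundle F} {ζ ζ' : Hom M₁ M₂} (h : ζ.toEquiv = ζ'.toEquiv) : ζ = ζ' := by
  cases ζ; cases ζ'; cases h; rfl

end MulLineBundle

end Literature.AnabelianGeometry.AbsoluteAnabelian
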